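import Summits.Langlands.Langlands.Theorems.PhantomRMYoshidaResiduallyYoshidaLiftingRibetNonsplitLattice
import Summits.Langlands.Langlands.Theorems.PhantomRMYoshidaResiduallyYoshidaLiftingRealisedClassSelmerDec
import Summits.Langlands.Langlands.Theorems.PhantomRMYoshidaResiduallyYoshidaLiftingAnchorOfSameClass
import Summits.Langlands.Langlands.Theorems.PhantomRMYoshidaResiduallyYoshidaLiftingDefs
import HarnessLib

/-!
# The anchor is DISCHARGED on rank-one data of the DECOMPOSITION-GROUP Greenberg–Selmer space
# (stub `stub_selmerAnchorRel_of_rankOneDec`, K2⁺) — line `sector-klingen-split`, crux `ResiduallyYoshidaLifting` (stmt-Langlands-13639)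

Lead prover-line-stmt-Langlands-13639-c5-0 (continuation c5, skeleton rev 13, 2026-08-17).

**Theorem (`stub_selmerAnchorRel_of_rankOneDec`, registered signature verbatim; the `let`-abbreviations `GrDec` — the nine-clause
decomposition-group Greenberg condition of N1⁺ at `v ∣ p` — and `Real` — "realised through an integral frame" — only keep the
registered text under the registry's length cap).**  On an admissible fibre (`σ̄, σ̄'` irreducible, non-conjugate, `DetC`, `p ≠ 2`)
carrying the crux's anchor `ρ₀` (irreducible, `Sh`, `Aut`), let the non-trivial class `B` be realised by an `Sh`-point `ρ`, and let
`S` be a set of places outside which `ρ` and `ρ₀` are unramified.  IF the Greenberg–Selmer cocycles in the STRONG sense (1-cocycles,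
locally constant, vanishing on the inertia groups above every `v ∉ S`, and `GrDec` at every `v ∣ p`) that are not coboundaries are
pairwise projectively equal modulo coboundaries — rank one of the CORRECT (smaller) Greenberg–Selmer space, a weaker hypothesis than
K2's (p161389) — THEN the anchor stub's conclusion holds for `B` with `ρ₁ := ρ₀` (Klingen parameter `c = 1`).

**Proof** (as K2, with K3⁺ in place of K3).  Ribet R1a for `ρ₀` gives a non-trivial class `B₀` realised by `ρ₀`; K3⁺
(`Fibre.stub_realisedClassSelmerDec`, p168375) makes both `B₀` and `B` strong Greenberg–Selmer cocycles for `S`; rank one gives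
`B = c • B₀ + δX`; p148691 `stub_anchorOfSameClass` re-frames `ρ₀` to realise `B`.  No new definitions, no named fact taken as a
hypothesis.
-/

noncomputable section

-- `Summit.Langlands.Langlands.…` (summit = sub-problem name, D-0017 layout) trips `dupNamespace` on every decl.
set_option linter.dupNamespace false
set_option autoImplicit false

open IsDedekindDomain Filter
open scoped Matrix
open Literature.NumberTheory.GaloisRepresentations Literature.NumberTheory.Automorphic
open Summit.Langlands.Langlands.Cruxes.ResiduallyYoshidaLifting.YoshidaDivisorSelmerCount

namespace Summit.Langlands.Langlands.Cruxes.ResiduallyYoshidaLifting.SectorKlingenSplit.Fibre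

/-- **Registered sub-goal K2⁺ `stub_selmerAnchorRel_of_rankOneDec`** (crux stmt-Langlands-13639, line `sector-klingen-split`, skeleton
rev 13): THE ANCHOR IS DISCHARGED ON RANK-ONE DATA OF THE DECOMPOSITION-GROUP GREENBERG–SELMER SPACE.  With `GrDec A v` the nine-clause
local condition of N1⁺ at `v ∣ p` and `Real r A` = "`r` realises `A` through an integral frame": if the strong Greenberg–Selmer cocycles
with ramification inside `S` that are not coboundaries are pairwise projectively equal modulo coboundaries, then a non-trivial class `B`
realised by an `Sh`-point unramified outside `S` is realised by the automorphic anchor `ρ₀` itself (`ρ₁ := ρ₀`, `c = 1`): Ribet R1a for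
`ρ₀` + K3⁺ for both realisers + rank one + p148691. [folklore] -/
theorem stub_selmerAnchorRel_of_rankOneDec :
    ∀ (p : ℕ) [Fact p.Prime], p ≠ 2 → ∀ (k : Type) [Field k] [CharP k p] [IsAlgClosed k]
    [TopologicalSpace k] [DiscreteTopology k] (red : Valued.integer (PadicAlgCl p) →+* k)
    (σ σ' : FramedGaloisRep ℚ k 2) (hcpt : isCompact_glFiniteIntegralLevel 4 ℚ) (ι : PadicAlgCl p ≃+* ℂ)
    (ρ₀ ρ : FramedGaloisRep ℚ (PadicAlgCl p) 4) (B : Field.absoluteGaloisGroup ℚ → Matrix (Fin 2) (Fin 2) k)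
    (S : Set (HeightOneSpectrum (NumberField.RingOfIntegers ℚ))),
    let GrDec := fun A (v : HeightOneSpectrum (NumberField.RingOfIntegers ℚ)) =>
      ∃ (X₀ : Matrix (Fin 2) (Fin 2) k) (x₁ y₁ : Fin 2 → k), x₁ ≠ 0 ∧ y₁ ≠ 0 ∧
        (∀ τ : Field.absoluteGaloisGroup (v.adicCompletion ℚ), ∃ a : k,
          (σ (absGaloisRestrict ℚ (v.adicCompletion ℚ) τ)).val *ᵥ x₁ = a • x₁) ∧
        (∀ τ : Field.absoluteGaloisGroup (v.adicCompletion ℚ), ∃ b : k,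
          (σ' (absGaloisRestrict ℚ (v.adicCompletion ℚ) τ)).val *ᵥ y₁ = b • y₁) ∧
        (∀ τ : Field.absoluteGaloisGroup (v.adicCompletion ℚ), ∃ c : k,
          (A (absGaloisRestrict ℚ (v.adicCompletion ℚ) τ) -
            ((σ (absGaloisRestrict ℚ (v.adicCompletion ℚ) τ)).val * X₀ -
              X₀ * (σ' (absGaloisRestrict ℚ (v.adicCompletion ℚ) τ)).val)) *ᵥ y₁ = c • x₁) ∧
        (∀ τ ∈ absInertia (v.adicCompletion ℚ),
          (σ (absGaloisRestrict ℚ (v.adicCompletion ℚ) τ)).val *ᵥ x₁ = x₁) ∧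
        (∀ τ ∈ absInertia (v.adicCompletion ℚ),
          (σ' (absGaloisRestrict ℚ (v.adicCompletion ℚ) τ)).val *ᵥ y₁ = y₁) ∧
        (∀ τ ∈ absInertia (v.adicCompletion ℚ),
          (A (absGaloisRestrict ℚ (v.adicCompletion ℚ) τ) -
            ((σ (absGaloisRestrict ℚ (v.adicCompletion ℚ) τ)).val * X₀ -
              X₀ * (σ' (absGaloisRestrict ℚ (v.adicCompletion ℚ) τ)).val)) *ᵥ y₁ = 0) ∧
        ∀ τ ∈ absInertia (v.adicCompletion ℚ), ∀ y : Fin 2 → k, ∃ c : k,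
          (A (absGaloisRestrict ℚ (v.adicCompletion ℚ) τ) -
            ((σ (absGaloisRestrict ℚ (v.adicCompletion ℚ) τ)).val * X₀ -
              X₀ * (σ' (absGaloisRestrict ℚ (v.adicCompletion ℚ) τ)).val)) *ᵥ y = c • x₁
    let Real := fun (r : FramedGaloisRep ℚ (PadicAlgCl p) 4) A =>
      ∃ (P : GL (Fin 4) (PadicAlgCl p))
        (rint : Field.absoluteGaloisGroup ℚ →* GL (Fin 4) (Valued.integer (PadicAlgCl p))) (h : GL (Fin 4) k),
        (∀ g, Matrix.GeneralLinearGroup.map (Valued.integer (PadicAlgCl p)).subtype (rint g) = P⁻¹ * r g * P) ∧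
        (∀ g, (Matrix.GeneralLinearGroup.map red (rint g)).val =
          h.val * Matrix.reindex finSumFinEquiv finSumFinEquiv
            (Matrix.fromBlocks (σ g).val (A g) 0 (σ' g).val) * (h⁻¹).val)
    σ.toGaloisRep.IsIrreducible → σ'.toGaloisRep.IsIrreducible → DetC p k σ σ' →
    (¬ ∃ g : GL (Fin 2) k, ∀ x, g * σ x * g⁻¹ = σ' x) →
    ρ₀.toGaloisRep.IsIrreducible → Sh p k red σ σ' ρ₀ → Aut p hcpt ι ρ₀ →
    (¬ ∃ X : Matrix (Fin 2) (Fin 2) k, ∀ g, B g = (σ g).val * X - X * (σ' g).val) →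
    Sh p k red σ σ' ρ → Real ρ B →
    (∀ v ∉ S, ρ.IsUnramifiedAt v ∧ ρ₀.IsUnramifiedAt v) →
    (∀ B₁ B₂ : Field.absoluteGaloisGroup ℚ → Matrix (Fin 2) (Fin 2) k,
      (∀ g g', B₁ (g * g') = (σ g).val * B₁ g' + B₁ g * (σ' g').val) →
      (∀ g g', B₂ (g * g') = (σ g).val * B₂ g' + B₂ g * (σ' g').val) →
      IsLocallyConstant B₁ → IsLocallyConstant B₂ →
      (∀ v ∉ S, ∀ 𝔓 ∈ v.primesAbove, ∀ i ∈ 𝔓.inertia (Field.absoluteGaloisGroup ℚ), B₁ i = 0 ∧ B₂ i = 0) →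
      (∀ v : HeightOneSpectrum (NumberField.RingOfIntegers ℚ), ((p : ℕ) : NumberField.RingOfIntegers ℚ) ∈ v.asIdeal →
        GrDec B₁ v ∧ GrDec B₂ v) →
      (¬ ∃ X : Matrix (Fin 2) (Fin 2) k, ∀ g, B₁ g = (σ g).val * X - X * (σ' g).val) →
      (¬ ∃ X : Matrix (Fin 2) (Fin 2) k, ∀ g, B₂ g = (σ g).val * X - X * (σ' g).val) →
      ∃ (c : kˣ) (X : Matrix (Fin 2) (Fin 2) k), ∀ g, B₂ g = (c : k) • B₁ g + ((σ g).val * X - X * (σ' g).val)) →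
    ∃ ρ₁ : FramedGaloisRep ℚ (PadicAlgCl p) 4, ρ₁.toGaloisRep.IsIrreducible ∧ Aut p hcpt ι ρ₁ ∧
      (∃ c : ℕ, (c : ZMod (p - 1)) = 1 ∧
        (∃ ν : Field.absoluteGaloisGroup ℚ → PadicAlgCl p, ρ₁.IsSymplecticWithMultiplierFun ν) ∧
        ∀ v : HeightOneSpectrum (NumberField.RingOfIntegers ℚ), ((p : ℕ) : NumberField.RingOfIntegers ℚ) ∈ v.asIdeal →
          ρ₁.IsGreenbergOrdinaryOfShapeAt v ![0, 0, c, c] ∧ ρ₁.IsResiduallyDistinguishedAt v ![0, 0, c, c]) ∧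
      Real ρ₁ B := by
  intro p _ hp k _ _ _ _ _ red σ σ' hcpt ι ρ₀ ρ B S GrDec Real hσ hσ' hdet hnc hρ₀ hSh₀ hA₀ hB hSh hreal hS hrank
  obtain ⟨P, rint, h, hP, hred⟩ := hreal
  -- Ribet (R1a) for the anchor: a non-trivial class `B₀` realised by `ρ₀`
  obtain ⟨P₀, rint₀, h₀, B₀, hP₀, hred₀, hB₀⟩ :=
    Ribet.stub_ribetNonsplitLattice p k red σ σ' ρ₀ hσ hσ' hnc hρ₀ hSh₀.2.2
  -- both realised classes are strong Greenberg–Selmer cocycles (K3⁺)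
  obtain ⟨hcoc₀, hlc₀, hur₀, hgr₀⟩ :=
    stub_realisedClassSelmerDec p hp k red σ σ' ρ₀ P₀ rint₀ h₀ B₀ hdet hSh₀ hP₀ hred₀
  obtain ⟨hcoc, hlc, hur, hgr⟩ := stub_realisedClassSelmerDec p hp k red σ σ' ρ P rint h B hdet hSh hP hred
  -- rank one: `B` is projectively equal to `B₀` modulo coboundaries
  obtain ⟨c, X, hcX⟩ := hrank B₀ B hcoc₀ hcoc hlc₀ hlc
    (fun v hv 𝔓 h𝔓 i hi => ⟨hur₀ v (hS v hv).2 𝔓 h𝔓 i hi, hur v (hS v hv).1 𝔓 h𝔓 i hi⟩)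
    (fun v hv => ⟨hgr₀ v hv, hgr v hv⟩) hB₀ hB
  -- the anchor realises every class projectively equal to its own (p148691)
  exact stub_anchorOfSameClass p hp k red σ σ' hcpt ι ρ₀ B₀ B hρ₀ hSh₀ hA₀ ⟨P₀, rint₀, h₀, hP₀, hred₀⟩ ⟨c, X, hcX⟩

end Summit.Langlands.Langlands.Cruxes.ResiduallyYoshidaLifting.SectorKlingenSplit.Fibre

end
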